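import Summits.AtomisticToContinuum.Crystallization.Theorems.FrustratedLawDichotomyTransportPriceFiniteEq

/-!
# FrustratedLawDichotomy · crux `AperiodicFrustratedLawGap` (stmt-AtomisticToContinuum-27623) — LOCALISATION V: FINITE CLUSTERS IN TRUNCATED FORCE BALANCE
# (decomp-a2c, prover hand 2, structural share, generation 3)

The last equilibrium constraint carried down to the finite cluster: FIRST-ORDER force balance.  At a force-balanced atom `p` of a rooted
`7/10`-hard-core configuration (`Σ_{q ≠ p} (|p−q|⁻⁸ − |p−q|⁻¹⁴)(p − q) = 0`, hand 1), the truncated force over the atoms within `Rc` of `p` is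
bounded by the explicit tail `TF(Rc) = (Rc⁻⁷ + Rc⁻¹)·250·(10/7)³·Rc⁻³` (`truncated_force_le`: `‖F(q)‖ ≤ (Rc⁻⁷ + Rc⁻¹)|p−q|⁻⁶` beyond `Rc`
by hand 1's `abs_coeff_mul_le`, and the two-scale shell sum on every finite far subset).  `truncatedSurplusPrice_of_forceFiniteClusterPrice`:
the FORCE-LOADED FINITE-CLUSTER PRICE — the finite-cluster price for clusters that are texture-charged, near-neighboured, locally
Laplacian-stable AND in truncated force balance (`‖Σ_{q∈ω, q≠p, ‖q−p‖≤Rc} (|p−q|⁻⁸ − |p−q|⁻¹⁴)(p−q)‖ ≤ TF(Rc)` at every `p ∈ ω` with `‖p‖ ≤ r`)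
— implies the truncated surplus price, hence the crux BY NAME, the registered stub verbatim and the `PeriodicChargeSplit` copy.  This is the
weakest, fully finite, equilibrium-loaded residual of the transport line.  All `[folklore]`.
-/

noncomputable section

namespace Summit.AtomisticToContinuum.Crystallization.Theorems.FrustratedLawDichotomyTransportPriceFiniteForce

open MeasureTheory Metric Set Filter
open scoped ENNReal Topology BigOperators
open Literature.MathematicalPhysics.StatisticalMechanics Literature.Probability.Process
open Summit.AtomisticToContinuum.Crystallization.Theorems.ChargedEnergyGapNegative (E3 eStar)
open Summit.AtomisticToContinuum.Crystallization.Theorems.FrustratedLawDichotomyTransportPriceTruncated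
  (aperiodicFrustratedLawGap_of_truncatedSurplusPrice aperiodicErgodicGap_of_truncatedSurplusPrice
    periodicChargeSplit_aperiodicFrustratedLawGap_of_truncatedSurplusPrice)
open Summit.AtomisticToContinuum.Crystallization.Theorems.FrustratedLawDichotomyTransportPriceFinite
  (preimage_sub_closedBall map_sub_apply_closedBall count_restrict_closedBall_eq_card setIntegral_map_sub_eq_sum)
open Summit.AtomisticToContinuum.Crystallization.Theorems.FrustratedLawDichotomyTransportPriceFiniteEq
  (laplacian_term_nonpos truncated_laplacian_nonneg)
open Summit.AtomisticToContinuum.Crystallization.Theorems.FrustratedLawDichotomyNashForceBalance (abs_coeff_mul_le)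
open Summit.AtomisticToContinuum.Crystallization.Theorems.ContactSaturationLadderWindowFilling (sum_inv_pow_six_le_two_scale_idx)
open Literature.Probability.Process.LocalConfig (finite_inter_of_separated)

/-- Two-scale shell sum for finite sets of atoms far from `p`: if all `q ∈ t` lie in the `7/10`-separated `S` with `dist p q ≥ ρ ≥ 7/10`, then
`Σ_{q∈t} |p−q|⁻⁶ ≤ 250·(10/7)³·ρ⁻³`. [folklore] -/
theorem finset_sum_inv_pow_six_le {S : Set E3} (hsep : ∀ a ∈ S, ∀ b ∈ S, a ≠ b → (7 : ℝ) / 10 ≤ dist a b) (p : E3) {ρ : ℝ}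
    (hρ : 7 / 10 ≤ ρ) (t : Finset E3) (ht : ∀ q ∈ t, q ∈ S ∧ ρ ≤ dist p q) :
    ∑ q ∈ t, (dist p q)⁻¹ ^ 6 ≤ 250 * (7 / 10 : ℝ)⁻¹ ^ 3 * ρ⁻¹ ^ 3 := by
  classical
  set y : Fin t.card → E3 := fun k => (t.equivFin.symm k : E3) with hy
  have hyinj : Function.Injective y := fun k l hkl => t.equivFin.symm.injective (Subtype.ext hkl)
  have hymem : ∀ k, y k ∈ t := fun k => (t.equivFin.symm k).2
  have h2 := sum_inv_pow_six_le_two_scale_idx y Finset.univ p (by norm_num : (0 : ℝ) < 7 / 10) hρ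
    (fun k _ l _ hkl => hsep (y k) (ht _ (hymem k)).1 (y l) (ht _ (hymem l)).1 (fun h => hkl (hyinj h)))
    (fun k _ => (ht _ (hymem k)).2)
  have hre : ∑ q ∈ t, (dist p q)⁻¹ ^ 6 = ∑ k : Fin t.card, (dist p (y k))⁻¹ ^ 6 := by
    have h1 : ∑ k : Fin t.card, (dist p (y k))⁻¹ ^ 6 = ∑ z : t, (dist p (z : E3))⁻¹ ^ 6 := by
      rw [hy]
      exact (Fintype.sum_equiv t.equivFin.symm (fun k => (dist p ((t.equivFin.symm k : t) : E3))⁻¹ ^ 6)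
        (fun z => (dist p (z : E3))⁻¹ ^ 6) (fun _ => rfl))
    rw [h1, Finset.sum_coe_sort t (fun z => (dist p z)⁻¹ ^ 6)]
  rw [hre]
  exact h2

/-- Norm of one force term: `‖(|p−q|⁻⁸ − |p−q|⁻¹⁴)(p − q)‖ ≤ (ρ⁻⁷ + ρ⁻¹)|p−q|⁻⁶` for `|p − q| ≥ ρ > 0` (hand 1's `abs_coeff_mul_le`). [folklore] -/
theorem norm_force_term_le {p q : E3} {ρ : ℝ} (hρ : 0 < ρ) (hpq : ρ ≤ dist p q) :
    ‖((dist p q)⁻¹ ^ 8 - (dist p q)⁻¹ ^ 14) • (p - q)‖ ≤ (ρ⁻¹ ^ 7 + ρ⁻¹) * (dist p q)⁻¹ ^ 6 := by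
  rw [norm_smul, Real.norm_eq_abs, ← dist_eq_norm]
  exact abs_coeff_mul_le hρ hpq

/-- **Truncated force balance on the cluster.**  At a force-balanced atom `p` (hand 1: `Σ_{q≠p} (|p−q|⁻⁸ − |p−q|⁻¹⁴)(p−q) = 0` as a `HasSum`) of a
rooted `7/10`-hard-core configuration `count|S` with `p ∈ S`, for `Rc ≥ 7/10` the truncated force over the atoms `q ≠ p` with `‖q − p‖ ≤ Rc` has norm
`≤ (Rc⁻⁷ + Rc⁻¹)·250·(10/7)³·Rc⁻³`. [folklore] -/
theorem truncated_force_le {S : Set E3} (hsep : ∀ a ∈ S, ∀ b ∈ S, a ≠ b → (7 : ℝ) / 10 ≤ dist a b) {p : E3} (hpS : p ∈ S)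
    {Rc : ℝ} (hRc : 7 / 10 ≤ Rc)
    (hsum : HasSum (fun q : {q : E3 // (Measure.count : Measure E3).restrict S {q} ≠ 0 ∧ q ≠ p} =>
      ((dist p (q : E3))⁻¹ ^ 8 - (dist p (q : E3))⁻¹ ^ 14) • (p - (q : E3))) 0)
    (t : Finset E3) (ht : ∀ q : E3, q ∈ t ↔ (q ∈ S ∧ q ≠ p) ∧ ‖q - p‖ ≤ Rc) :
    ‖∑ q ∈ t, ((dist p q)⁻¹ ^ 8 - (dist p q)⁻¹ ^ 14) • (p - q)‖ ≤ (Rc⁻¹ ^ 7 + Rc⁻¹) * (250 * (7 / 10 : ℝ)⁻¹ ^ 3 * Rc⁻¹ ^ 3) := by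
  classical
  have h7 : (0 : ℝ) < 7 / 10 := by norm_num
  have hRc0 : 0 < Rc := h7.trans_le hRc
  set T := {q : E3 // (Measure.count : Measure E3).restrict S {q} ≠ 0 ∧ q ≠ p} with hT
  set f : T → E3 := fun q => ((dist p (q : E3))⁻¹ ^ 8 - (dist p (q : E3))⁻¹ ^ 14) • (p - (q : E3)) with hf
  have hmemT : ∀ q : T, (q : E3) ∈ S ∧ (q : E3) ≠ p := fun q =>
    ⟨(count_restrict_singleton_ne_zero_iff S q).mp q.2.1, q.2.2⟩
  have hdistT : ∀ q : T, 7 / 10 ≤ dist p (q : E3) := fun q => hsep p hpS q (hmemT q).1 (hmemT q).2.symm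
  -- summability of the norms via the r⁻⁶ shell sums
  have h6 : Summable fun q : T => (dist p (q : E3))⁻¹ ^ 6 := by
    refine summable_of_sum_le (fun q => by positivity) (c := 250 * (7 / 10 : ℝ)⁻¹ ^ 3 * (7 / 10 : ℝ)⁻¹ ^ 3) fun u => ?_
    have hmap : ∑ x ∈ u, (dist p (x : E3))⁻¹ ^ 6 = ∑ q ∈ u.map (Function.Embedding.subtype _), (dist p q)⁻¹ ^ 6 := by
      rw [Finset.sum_map]; rfl
    rw [hmap]
    refine finset_sum_inv_pow_six_le hsep p le_rfl _ fun q hq => ?_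
    obtain ⟨x, -, rfl⟩ := Finset.mem_map.mp hq
    exact ⟨(hmemT x).1, hdistT x⟩
  have hnorm : Summable fun q : T => ‖f q‖ := by
    refine Summable.of_nonneg_of_le (fun q => norm_nonneg _) (fun q => ?_) (h6.mul_left ((7 / 10 : ℝ)⁻¹ ^ 7 + (7 / 10 : ℝ)⁻¹))
    exact norm_force_term_le h7 (hdistT q)
  -- near finset and complement
  have hfin : (closedBall p Rc ∩ S).Finite := finite_inter_of_separated h7 hsep (isCompact_closedBall p Rc)
  have hnear : {q : T | ‖(q : E3) - p‖ ≤ Rc}.Finite := by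
    refine Finite.of_injOn (f := fun q : T => (q : E3)) (fun q hq => ?_) (Subtype.val_injective.injOn) hfin
    exact ⟨by rw [mem_closedBall, dist_eq_norm]; exact hq, (hmemT q).1⟩
  set s : Finset T := hnear.toFinset with hs
  have hsplit := hsum.summable.sum_add_tsum_compl (s := s)
  rw [hsum.tsum_eq] at hsplit
  have hsum_s : ∑ q ∈ s, f q = -∑' q : ↑((↑s : Set T)ᶜ), f q := eq_neg_of_add_eq_zero_left hsplit
  have hfar : ∀ q : ↑((↑s : Set T)ᶜ), Rc ≤ dist p ((q : T) : E3) := fun q => by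
    have h1 : (q : T) ∉ (↑s : Set T) := q.2
    have h2 : (q : T) ∉ hnear.toFinset := h1
    rw [Finite.mem_toFinset] at h2
    have h3 : ¬ ‖((q : T) : E3) - p‖ ≤ Rc := h2
    rw [dist_comm, dist_eq_norm]; exact (not_le.mp h3).le
  have hnormc : Summable fun q : ↑((↑s : Set T)ᶜ) => ‖f q‖ := hnorm.subtype _
  have h6c : Summable fun q : ↑((↑s : Set T)ᶜ) => (dist p ((q : T) : E3))⁻¹ ^ 6 := h6.subtype _
  have htail6 : ∑' q : ↑((↑s : Set T)ᶜ), (dist p ((q : T) : E3))⁻¹ ^ 6 ≤ 250 * (7 / 10 : ℝ)⁻¹ ^ 3 * Rc⁻¹ ^ 3 := by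
    refine h6c.tsum_le_of_sum_le fun u => ?_
    set emb : ↑((↑s : Set T)ᶜ) ↪ E3 := ⟨fun q => ((q : T) : E3), fun a b hab => Subtype.ext (Subtype.ext hab)⟩ with hemb
    have hmap : ∑ x ∈ u, (dist p ((x : T) : E3))⁻¹ ^ 6 = ∑ q ∈ u.map emb, (dist p q)⁻¹ ^ 6 := by
      rw [Finset.sum_map]; rfl
    rw [hmap]
    refine finset_sum_inv_pow_six_le hsep p hRc _ fun q hq => ?_
    obtain ⟨x, -, rfl⟩ := Finset.mem_map.mp hq
    exact ⟨(hmemT x).1, hfar x⟩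
  -- assemble
  have hmap : s.map (Function.Embedding.subtype _) = t := by
    ext q
    rw [Finset.mem_map, ht]
    constructor
    · rintro ⟨x, hx, rfl⟩
      rw [hs, Finite.mem_toFinset] at hx
      exact ⟨hmemT x, hx⟩
    · rintro ⟨⟨hqS, hqp⟩, hq⟩
      refine ⟨⟨q, (count_restrict_singleton_ne_zero_iff S q).mpr hqS, hqp⟩, ?_, rfl⟩
      rw [hs, Finite.mem_toFinset]
      exact hq
  have hsum_t : ∑ q ∈ t, ((dist p q)⁻¹ ^ 8 - (dist p q)⁻¹ ^ 14) • (p - q) = ∑ q ∈ s, f q := by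
    rw [← hmap, Finset.sum_map]; rfl
  rw [hsum_t, hsum_s, norm_neg]
  calc ‖∑' q : ↑((↑s : Set T)ᶜ), f q‖ ≤ ∑' q : ↑((↑s : Set T)ᶜ), ‖f q‖ := norm_tsum_le_tsum_norm hnormc
    _ ≤ ∑' q : ↑((↑s : Set T)ᶜ), (Rc⁻¹ ^ 7 + Rc⁻¹) * (dist p ((q : T) : E3))⁻¹ ^ 6 :=
        hnormc.tsum_le_tsum (fun q => norm_force_term_le hRc0 (hfar q)) (h6c.mul_left _)
    _ = (Rc⁻¹ ^ 7 + Rc⁻¹) * ∑' q : ↑((↑s : Set T)ᶜ), (dist p ((q : T) : E3))⁻¹ ^ 6 := tsum_mul_left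
    _ ≤ (Rc⁻¹ ^ 7 + Rc⁻¹) * (250 * (7 / 10 : ℝ)⁻¹ ^ 3 * Rc⁻¹ ^ 3) := by gcongr

/-- **FORCE-LOADED FINITE-CLUSTER PRICE ⟹ TRUNCATED SURPLUS PRICE.** [folklore] -/
theorem truncatedSurplusPrice_of_forceFiniteClusterPrice
    (h : ∀ δ : ℝ, 0 < δ → ∀ R₇ R₈ R₉ : ℝ, let Gy : ℝ → (N : ℕ) → (Fin N → EuclideanSpace ℝ (Fin 3)) → Fin N → Prop := fun η N y j => let d : ℝ := sInf ((fun z => dist z (y (j : Fin N))) '' (Set.range (y) \ {(y (j : Fin N))})); let T : Set (EuclideanSpace ℝ (Fin 3)) := {z : EuclideanSpace ℝ (Fin 3) | z ∈ Set.range (y) ∧ z ≠ (y (j : Fin N)) ∧ dist z (y (j : Fin N)) < 13 / 10 * d}; ∃ A : EuclideanSpace ℝ (Fin 3) →ₗᵢ[ℝ] EuclideanSpace ℝ (Fin 3), (∃ e : ↥T ≃ ↥Literature.Geometry.DiscreteGeometry.fccKissingPattern, ∀ t : ↥T, dist (d⁻¹ • ((t : EuclideanSpace ℝ (Fin 3))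 - (y (j : Fin N)))) (A ((e t : ↥Literature.Geometry.DiscreteGeometry.fccKissingPattern) : EuclideanSpace ℝ (Fin 3))) ≤ η) ∨ (∃ e : ↥T ≃ ↥Literature.Geometry.DiscreteGeometry.hcpKissingPattern, ∀ t : ↥T, dist (d⁻¹ • ((t : EuclideanSpace ℝ (Fin 3)) - (y (j : Fin N)))) (A ((e t : ↥Literature.Geometry.DiscreteGeometry.hcpKissingPattern) : EuclideanSpace ℝ (Fin 3))) ≤ η); let TexBall : (N : ℕ) → (Fin N → EuclideanSpace ℝ (Fin 3)) → Fin N → ℝ → ℝ → ℝ → ℝ → Prop := fun N y i R R₇ R₈ R₉ => (∀ a b : Fin N, a ≠ b → (7 : ℝ) / 10 ≤ dist (y a) (y b)) ∧ (∀ j : Fin N, dist (y j) (y i) ≤ R → ¬ Gy (1 / 20) N (y) j) ∧ (∀ j : Fin N, dist (y j) (y i) ≤ R → ¬ ((∀ j' : Fin N, dist (y j') (y j) ≤ R₇ → ¬ Gy (1 / 20) N (y) j') ∧ (∀ z : EuclideanSpace ℝ (Fin 3), dist z (y j) ≤ R₇ → ∃ k : Fin N, dist z (y k) ≤ 1) ∧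 (∀ j' : Fin N, dist (y j') (y j) ≤ R₇ → (let d : ℝ := sInf ((fun z => dist z (y j')) '' (Set.range (y) \ {(y j')})); ∀ k : Fin N, y k ≠ y j' → dist (y k) (y j') < 27 / 20 * d → 5 ≤ Nat.card {m : Fin N // y m ≠ y j' ∧ dist (y m) (y j') < 27 / 20 * d ∧ y m ≠ y k ∧ dist (y m) (y k) < 27 / 20 * d})))) ∧ (∀ j : Fin N, dist (y j) (y i) ≤ R → ∃ k : Fin N, dist (y k) (y j) ≤ R₈ ∧ Gy (1 / 8) N (y) k) ∧ (∀ j : Fin N, dist (y j) (y i) ≤ R → ¬ ((∀ j' : Fin N, dist (y j') (y j) ≤ R₉ → ¬ Gy (1 / 20) N (y) j') ∧ (Nat.card {j' : Fin N // dist (y j') (y j) ≤ R₉ ∧ ¬ Gy (1 / 8) N (y) j'} : ℝ) ≤ 1 / 2 * (Nat.card {j' : Fin N // dist (y j') (y j) ≤ R₉} : ℝ) ∧ (∀ j' : Fin N, dist (y j') (y j) ≤ R₉ → ¬ Gy (1 / 8) N (y) j' → ¬ (let d : ℝ := sInf ((fun z => dist z (y j')) '' (Set.range (y) \ {(y j')}));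 ∀ k : Fin N, y k ≠ y j' → dist (y k) (y j') < 27 / 20 * d → 5 ≤ Nat.card {m : Fin N // y m ≠ y j' ∧ dist (y m) (y j') < 27 / 20 * d ∧ y m ≠ y k ∧ dist (y m) (y k) < 27 / 20 * d})))); ∃ r : ℝ, 0 < r ∧ ∃ Rc : ℝ, 6 / 5 ≤ Rc ∧ ∀ ω : Finset (EuclideanSpace ℝ (Fin 3)), (0 : EuclideanSpace ℝ (Fin 3)) ∈ ω → (∀ p ∈ ω, ‖p‖ ≤ 2 * r + Rc + 1) → (∀ a ∈ ω, ∀ b ∈ ω, a ≠ b → δ ≤ dist a b) → (∀ a ∈ ω, ∀ b ∈ ω, a ≠ b → (7 : ℝ) / 10 ≤ dist a b) → (∀ q ∈ ω, ‖q‖ ≤ r → ∀ ε : ℝ, 0 < ε → ε ≤ 1 → ∃ (N : ℕ) (y : Fin N → EuclideanSpace ℝ (Fin 3)) (i : Fin N), TexBall N y i (r + Rc) R₇ R₈ R₉ ∧ (∀ p ∈ ω, dist p q ≤ r + Rc → ∃ k : Fin N, dist (y k - y i) (p - q) ≤ ε) ∧ (∀ k : Fin N, dist (y k) (y i) ≤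 r + Rc → ∃ p ∈ ω, dist (y k - y i) (p - q) ≤ ε)) → (∀ p ∈ ω, ‖p‖ ≤ r → ∃ q ∈ ω, q ≠ p ∧ dist p q ^ 6 ≤ 11 / 5) → (∀ p ∈ ω, ‖p‖ ≤ r → 0 ≤ ∑ q ∈ ω.filter (fun q : EuclideanSpace ℝ (Fin 3) => q ≠ p ∧ ‖q - p‖ ≤ Rc), (11 * (dist p q)⁻¹ ^ 14 - 5 * (dist p q)⁻¹ ^ 8)) → (∀ p ∈ ω, ‖p‖ ≤ r → ‖∑ q ∈ ω.filter (fun q : EuclideanSpace ℝ (Fin 3) => q ≠ p ∧ ‖q - p‖ ≤ Rc), (((dist p q)⁻¹ ^ 8 - (dist p q)⁻¹ ^ 14) • (p - q))‖ ≤ (Rc⁻¹ ^ 7 + Rc⁻¹) * (250 * (7 / 10 : ℝ)⁻¹ ^ 3 * Rc⁻¹ ^ 3)) → 0 < (∑ y ∈ ω.filter (fun y : EuclideanSpace ℝ (Fin 3) => ‖y‖ ≤ r), ((∑ q ∈ ω.filter (fun q : EuclideanSpace ℝ (Fin 3) => ‖q - y‖ ≤ Rc), Literature.MathematicalPhysics.StatisticalMechanics.lennardJones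 ‖q - y‖) / 2 - ((7 / 10 : ℝ)⁻¹ ^ 6 / 12 + 1 / 6) * (250 * (7 / 10 : ℝ)⁻¹ ^ 3 * Rc⁻¹ ^ 3) / 2 - (⨅ Q : Literature.MathematicalPhysics.StatisticalMechanics.PeriodicConfiguration 3, Q.energyPerParticle Literature.MathematicalPhysics.StatisticalMechanics.lennardJones)) / ((ω.filter (fun q : EuclideanSpace ℝ (Fin 3) => ‖q - y‖ ≤ r)).card : ℝ))) :
    ∀ δ : ℝ, 0 < δ → ∀ R₇ R₈ R₉ : ℝ, let Gy : ℝ → (N : ℕ) → (Fin N → EuclideanSpace ℝ (Fin 3)) → Fin N → Prop := fun η N y j => let d : ℝ := sInf ((fun z => dist z (y (j : Fin N))) '' (Set.range (y) \ {(y (j : Fin N))})); let T : Set (EuclideanSpace ℝ (Fin 3)) := {z : EuclideanSpace ℝ (Fin 3) | z ∈ Set.range (y) ∧ z ≠ (y (j : Fin N)) ∧ dist z (y (j : Fin N)) < 13 / 10 * d}; ∃ A : EuclideanSpace ℝ (Fin 3) →ₗᵢ[ℝ] EuclideanSpace ℝ (Fin 3), (∃ e : ↥T ≃ ↥Literature.Geometry.DiscreteGeometry.fccKissingPattern,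 ∀ t : ↥T, dist (d⁻¹ • ((t : EuclideanSpace ℝ (Fin 3)) - (y (j : Fin N)))) (A ((e t : ↥Literature.Geometry.DiscreteGeometry.fccKissingPattern) : EuclideanSpace ℝ (Fin 3))) ≤ η) ∨ (∃ e : ↥T ≃ ↥Literature.Geometry.DiscreteGeometry.hcpKissingPattern, ∀ t : ↥T, dist (d⁻¹ • ((t : EuclideanSpace ℝ (Fin 3)) - (y (j : Fin N)))) (A ((e t : ↥Literature.Geometry.DiscreteGeometry.hcpKissingPattern) : EuclideanSpace ℝ (Fin 3))) ≤ η); let TexBall : (N : ℕ) → (Fin N → EuclideanSpace ℝ (Fin 3)) → Fin N → ℝ → ℝ → ℝ → ℝ → Prop := fun N y i R R₇ R₈ R₉ => (∀ a b : Fin N, a ≠ b → (7 : ℝ) / 10 ≤ dist (y a) (y b)) ∧ (∀ j : Fin N, dist (y j) (y i) ≤ R → ¬ Gy (1 / 20) N (y) j) ∧ (∀ j : Fin N, dist (y j) (y i) ≤ R → ¬ ((∀ j' : Fin N, dist (y j') (y j) ≤ R₇ → ¬ Gy (1 / 20) N (y) j') ∧ (∀ z : EuclideanSpace ℝ (Fin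 3), dist z (y j) ≤ R₇ → ∃ k : Fin N, dist z (y k) ≤ 1) ∧ (∀ j' : Fin N, dist (y j') (y j) ≤ R₇ → (let d : ℝ := sInf ((fun z => dist z (y j')) '' (Set.range (y) \ {(y j')})); ∀ k : Fin N, y k ≠ y j' → dist (y k) (y j') < 27 / 20 * d → 5 ≤ Nat.card {m : Fin N // y m ≠ y j' ∧ dist (y m) (y j') < 27 / 20 * d ∧ y m ≠ y k ∧ dist (y m) (y k) < 27 / 20 * d})))) ∧ (∀ j : Fin N, dist (y j) (y i) ≤ R → ∃ k : Fin N, dist (y k) (y j) ≤ R₈ ∧ Gy (1 / 8) N (y) k) ∧ (∀ j : Fin N, dist (y j) (y i) ≤ R → ¬ ((∀ j' : Fin N, dist (y j') (y j) ≤ R₉ → ¬ Gy (1 / 20) N (y) j') ∧ (Nat.card {j' : Fin N // dist (y j') (y j) ≤ R₉ ∧ ¬ Gy (1 / 8) N (y) j'} : ℝ) ≤ 1 / 2 * (Nat.card {j' : Fin N // dist (y j') (y j) ≤ R₉} : ℝ) ∧ (∀ j' : Fin N, dist (y j') (y j) ≤ R₉ → ¬ Gy (1 / 8) N (y) j' →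 ¬ (let d : ℝ := sInf ((fun z => dist z (y j')) '' (Set.range (y) \ {(y j')})); ∀ k : Fin N, y k ≠ y j' → dist (y k) (y j') < 27 / 20 * d → 5 ≤ Nat.card {m : Fin N // y m ≠ y j' ∧ dist (y m) (y j') < 27 / 20 * d ∧ y m ≠ y k ∧ dist (y m) (y k) < 27 / 20 * d})))); let Appr : MeasureTheory.Measure (EuclideanSpace ℝ (Fin 3)) → ℝ → ℝ → ℝ → Prop := fun μ R₇ R₈ R₉ => ∀ q : EuclideanSpace ℝ (Fin 3), μ {q} ≠ 0 → ∀ R ε : ℝ, 0 < ε → ∃ (N : ℕ) (y : Fin N → EuclideanSpace ℝ (Fin 3)) (i : Fin N), TexBall N y i R R₇ R₈ R₉ ∧ (∀ p : EuclideanSpace ℝ (Fin 3), μ {p} ≠ 0 → dist p q ≤ R → ∃ k : Fin N, dist (y k - y i) (p - q) ≤ ε) ∧ (∀ k : Fin N, dist (y k) (y i) ≤ R → ∃ p : EuclideanSpace ℝ (Fin 3), μ {p} ≠ 0 ∧ dist (y k - y i) (p - q) ≤ ε); ∃ r : ℝ, 0 < r ∧ ∃ Rc : ℝ, 7 / 10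 ≤ Rc ∧ (∀ μ : MeasureTheory.Measure (EuclideanSpace ℝ (Fin 3)), Literature.Probability.Process.IsRootedHardCore δ μ → Literature.Probability.Process.IsRootedHardCore (7 / 10) μ → Appr μ R₇ R₈ R₉ → (∀ p : EuclideanSpace ℝ (Fin 3), μ {p} ≠ 0 → ∀ y : EuclideanSpace ℝ (Fin 3), (∀ q : EuclideanSpace ℝ (Fin 3), μ {q} ≠ 0 → q ≠ p → y ≠ q) → ∑' q : {q : EuclideanSpace ℝ (Fin 3) // μ {q} ≠ 0 ∧ q ≠ p}, Literature.MathematicalPhysics.StatisticalMechanics.lennardJones (dist p (q : EuclideanSpace ℝ (Fin 3))) ≤ ∑' q : {q : EuclideanSpace ℝ (Fin 3) // μ {q} ≠ 0 ∧ q ≠ p}, Literature.MathematicalPhysics.StatisticalMechanics.lennardJones (dist y (q : EuclideanSpace ℝ (Fin 3)))) → (∀ p : EuclideanSpace ℝ (Fin 3), μ {p} ≠ 0 → HasSum (fun q : {q : EuclideanSpace ℝ (Fin 3) // μ {q} ≠ 0 ∧ q ≠ p} => ((dist p (q : EuclideanSpace ℝ (Fin 3)))⁻¹ ^ 8 - (dist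 p (q : EuclideanSpace ℝ (Fin 3)))⁻¹ ^ 14) • (p - (q : EuclideanSpace ℝ (Fin 3)))) 0 ∧ (∃ L : ℝ, 0 ≤ L ∧ HasSum (fun q : {q : EuclideanSpace ℝ (Fin 3) // μ {q} ≠ 0 ∧ q ≠ p} => 11 * (dist p (q : EuclideanSpace ℝ (Fin 3)))⁻¹ ^ 14 - 5 * (dist p (q : EuclideanSpace ℝ (Fin 3)))⁻¹ ^ 8) L) ∧ ((∃ q : EuclideanSpace ℝ (Fin 3), μ {q} ≠ 0 ∧ q ≠ p) → ∃ q : EuclideanSpace ℝ (Fin 3), μ {q} ≠ 0 ∧ q ≠ p ∧ dist p q ^ 6 ≤ 11 / 5)) → {p : EuclideanSpace ℝ (Fin 3) | μ {p} ≠ 0}.Infinite → ¬ (∃ Q : Literature.MathematicalPhysics.StatisticalMechanics.PeriodicConfiguration 3, ∃ t : EuclideanSpace ℝ (Fin 3), {p : EuclideanSpace ℝ (Fin 3) | μ {p} ≠ 0} = (fun s => s + t) '' Q.points) → 0 < (∫ y in Metric.closedBall (0 : EuclideanSpace ℝ (Fin 3)) r, ((∫ z in Metric.closedBall (0 : EuclideanSpace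 ℝ (Fin 3)) Rc, Literature.MathematicalPhysics.StatisticalMechanics.lennardJones ‖z‖ ∂(MeasureTheory.Measure.map (fun z : EuclideanSpace ℝ (Fin 3) => z - y) μ)) / 2 - ((7 / 10 : ℝ)⁻¹ ^ 6 / 12 + 1 / 6) * (250 * (7 / 10 : ℝ)⁻¹ ^ 3 * Rc⁻¹ ^ 3) / 2 - (⨅ Q : Literature.MathematicalPhysics.StatisticalMechanics.PeriodicConfiguration 3, Q.energyPerParticle Literature.MathematicalPhysics.StatisticalMechanics.lennardJones)) / ((MeasureTheory.Measure.map (fun z : EuclideanSpace ℝ (Fin 3) => z - y) μ) (Metric.closedBall (0 : EuclideanSpace ℝ (Fin 3)) r)).toReal ∂μ)) := by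
  classical
  intro δ hδ R₇ R₈ R₉
  have h' := h δ hδ R₇ R₈ R₉
  dsimp only at h' ⊢
  obtain ⟨r, hr, Rc, hRc, hF⟩ := h'
  refine ⟨r, hr, Rc, by linarith, fun μ hμδ hμ7 hd he hE hinf hnp => ?_⟩
  obtain ⟨S, h0S, hsep, hμS⟩ := id hμ7
  have h7 : (0 : ℝ) < 7 / 10 := by norm_num
  have hsepδ : ∀ a ∈ S, ∀ b ∈ S, a ≠ b → δ ≤ dist a b := by
    obtain ⟨S', -, hsep', hμS'⟩ := hμδ
    intro a ha b hb hab
    have ha' : a ∈ S' := (count_restrict_singleton_ne_zero_iff S' a).mp (by rw [← hμS', hμS]; exact (count_restrict_singleton_ne_zero_iff S a).mpr ha)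
    have hb' : b ∈ S' := (count_restrict_singleton_ne_zero_iff S' b).mp (by rw [← hμS', hμS]; exact (count_restrict_singleton_ne_zero_iff S b).mpr hb)
    exact hsep' a ha' b hb' hab
  set ρ : ℝ := 2 * r + Rc + 1 with hρ
  have hrρ : r ≤ ρ := by rw [hρ]; linarith
  have hρ0 : 0 ≤ ρ := by rw [hρ]; linarith
  have hfinρ : (closedBall (0 : E3) ρ ∩ S).Finite := finite_inter_of_separated h7 hsep (isCompact_closedBall (0 : E3) ρ)
  set ω : Finset E3 := hfinρ.toFinset with hω
  have hmemω : ∀ p : E3, p ∈ ω ↔ ‖p‖ ≤ ρ ∧ p ∈ S := fun p => by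
    rw [hω, Finite.mem_toFinset, mem_inter_iff, mem_closedBall, dist_zero_right]
  have h0ω : (0 : E3) ∈ ω := (hmemω 0).mpr ⟨by rw [norm_zero]; exact hρ0, h0S⟩
  have hballω : ∀ p ∈ ω, ‖p‖ ≤ 2 * r + Rc + 1 := fun p hp => by have := ((hmemω p).mp hp).1; rw [hρ] at this; exact this
  have hsepω : ∀ a ∈ ω, ∀ b ∈ ω, a ≠ b → δ ≤ dist a b := fun a ha b hb hab =>
    hsepδ a ((hmemω a).mp ha).2 b ((hmemω b).mp hb).2 hab
  have hsep7ω : ∀ a ∈ ω, ∀ b ∈ ω, a ≠ b → (7 : ℝ) / 10 ≤ dist a b := fun a ha b hb hab =>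
    hsep a ((hmemω a).mp ha).2 b ((hmemω b).mp hb).2 hab
  have hball_sub : ∀ y : E3, ‖y‖ ≤ r → ∀ R : ℝ, R ≤ r + Rc → ∀ q : E3, ‖q - y‖ ≤ R → ‖q‖ ≤ ρ := by
    intro y hy R hR q hq
    calc ‖q‖ = ‖(q - y) + y‖ := by rw [sub_add_cancel]
      _ ≤ ‖q - y‖ + ‖y‖ := norm_add_le _ _
      _ ≤ ρ := by rw [hρ]; linarith
  have hatom : ∀ p ∈ ω, μ {p} ≠ 0 := fun p hp => by
    rw [hμS]; exact (count_restrict_singleton_ne_zero_iff S p).mpr ((hmemω p).mp hp).2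
  -- the finite inequality, with texture / near neighbour / truncated Laplacian stability supplied from the configuration
  have hpos := hF ω h0ω hballω hsepω hsep7ω (fun q hq hqr ε hε hε1 => by
      obtain ⟨N, y, i, hT, hm1, hm2⟩ := hd q (hatom q hq) (r + Rc) ε hε
      refine ⟨N, y, i, hT, fun p hp hpq => hm1 p (hatom p hp) hpq, fun k hk => ?_⟩
      obtain ⟨p, hp0, hpk⟩ := hm2 k hk
      have hpS : p ∈ S := by rw [hμS] at hp0; exact (count_restrict_singleton_ne_zero_iff S p).mp hp0
      refine ⟨p, (hmemω p).mpr ⟨?_, hpS⟩, hpk⟩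
      have h1 : ‖p - q‖ ≤ ‖y k - y i‖ + ε := by
        have hdk : ‖p - q - (y k - y i)‖ ≤ ε := by
          rw [← dist_eq_norm, dist_comm]; exact hpk
        calc ‖p - q‖ = ‖(p - q - (y k - y i)) + (y k - y i)‖ := by rw [sub_add_cancel]
          _ ≤ ‖p - q - (y k - y i)‖ + ‖y k - y i‖ := norm_add_le _ _
          _ ≤ ‖y k - y i‖ + ε := by linarith
      have h2 : ‖y k - y i‖ ≤ r + Rc := by rw [← dist_eq_norm]; exact hk
      calc ‖p‖ = ‖(p - q) + q‖ := by rw [sub_add_cancel]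
        _ ≤ ‖p - q‖ + ‖q‖ := norm_add_le _ _
        _ ≤ ρ := by rw [hρ]; linarith)
    (fun p hp hpr => by
      -- near neighbour within (11/5)^(1/6) < 6/5, hence inside the cluster
      obtain ⟨-, -, hnear⟩ := hE p (hatom p hp)
      obtain ⟨q', hq'mem, hq'p⟩ := hinf.exists_notMem_finset {p}
      have hq'ne : q' ≠ p := fun h => hq'p (by rw [h]; exact Finset.mem_singleton_self p)
      obtain ⟨q, hq0, hqp, hqd⟩ := hnear ⟨q', hq'mem, hq'ne⟩
      have hqS : q ∈ S := by rw [hμS] at hq0; exact (count_restrict_singleton_ne_zero_iff S q).mp hq0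
      have hdist : dist p q ≤ 6 / 5 := by
        by_contra hlt
        have hgt : 6 / 5 < dist p q := not_le.mp hlt
        have : (6 / 5 : ℝ) ^ 6 < dist p q ^ 6 := by gcongr
        norm_num at this
        linarith
      refine ⟨q, (hmemω q).mpr ⟨?_, hqS⟩, hqp, hqd⟩
      have : ‖q - p‖ ≤ 6 / 5 := by rw [← dist_eq_norm, dist_comm]; exact hdist
      calc ‖q‖ = ‖(q - p) + p‖ := by rw [sub_add_cancel]
        _ ≤ ‖q - p‖ + ‖p‖ := norm_add_le _ _
        _ ≤ ρ := by rw [hρ]; linarith)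
    (fun p hp hpr => by
      obtain ⟨-, ⟨L, hL0, hsum⟩, -⟩ := hE p (hatom p hp)
      rw [hμS] at hsum
      refine truncated_laplacian_nonneg hsep p hRc hL0 hsum _ fun q => ?_
      rw [Finset.mem_filter, hmemω]
      constructor
      · rintro ⟨⟨-, hqS⟩, hqp, hq⟩; exact ⟨⟨hqS, hqp⟩, hq⟩
      · rintro ⟨⟨hqS, hqp⟩, hq⟩; exact ⟨⟨hball_sub p hpr Rc (by linarith) q hq, hqS⟩, hqp, hq⟩)
    (fun p hp hpr => by
      obtain ⟨hforce, -, -⟩ := hE p (hatom p hp)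
      rw [hμS] at hforce
      refine truncated_force_le hsep ((hmemω p).mp hp).2 (by linarith) hforce _ fun q => ?_
      rw [Finset.mem_filter, hmemω]
      constructor
      · rintro ⟨⟨-, hqS⟩, hqp, hq⟩; exact ⟨⟨hqS, hqp⟩, hq⟩
      · rintro ⟨⟨hqS, hqp⟩, hq⟩; exact ⟨⟨hball_sub p hpr Rc (by linarith) q hq, hqS⟩, hqp, hq⟩)
  -- the truncated integral IS the finite sum
  have hfinr : (closedBall (0 : E3) r ∩ S).Finite := finite_inter_of_separated h7 hsep (isCompact_closedBall (0 : E3) r)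
  have hωr : hfinr.toFinset = ω.filter (fun y : E3 => ‖y‖ ≤ r) := by
    ext y
    rw [Finite.mem_toFinset, Finset.mem_filter, hmemω, mem_inter_iff, mem_closedBall, dist_zero_right]
    constructor
    · rintro ⟨hy, hyS⟩; exact ⟨⟨hy.trans hrρ, hyS⟩, hy⟩
    · rintro ⟨⟨-, hyS⟩, hy⟩; exact ⟨hy, hyS⟩
  have hfilt : ∀ y : E3, ‖y‖ ≤ r → ∀ R : ℝ, R ≤ r + Rc → ∀ hfin : (closedBall y R ∩ S).Finite,
      hfin.toFinset = ω.filter (fun q : E3 => ‖q - y‖ ≤ R) := by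
    intro y hy R hR hfin
    ext q
    rw [Finite.mem_toFinset, Finset.mem_filter, hmemω, mem_inter_iff, mem_closedBall, dist_eq_norm]
    constructor
    · rintro ⟨hq, hqS⟩; exact ⟨⟨hball_sub y hy R hR q hq, hqS⟩, hq⟩
    · rintro ⟨⟨-, hqS⟩, hq⟩; exact ⟨hq, hqS⟩
  have heq : (∫ y in closedBall (0 : E3) r, ((∫ z in closedBall (0 : E3) Rc, lennardJones ‖z‖ ∂(μ.map fun z : E3 => z - y)) / 2 -
        ((7 / 10 : ℝ)⁻¹ ^ 6 / 12 + 1 / 6) * (250 * (7 / 10 : ℝ)⁻¹ ^ 3 * Rc⁻¹ ^ 3) / 2 -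
        (⨅ Q : PeriodicConfiguration 3, Q.energyPerParticle lennardJones)) /
        ((μ.map fun z : E3 => z - y) (closedBall (0 : E3) r)).toReal ∂μ) =
      ∑ y ∈ ω.filter (fun y : E3 => ‖y‖ ≤ r),
        ((∑ q ∈ ω.filter (fun q : E3 => ‖q - y‖ ≤ Rc), lennardJones ‖q - y‖) / 2 -
          ((7 / 10 : ℝ)⁻¹ ^ 6 / 12 + 1 / 6) * (250 * (7 / 10 : ℝ)⁻¹ ^ 3 * Rc⁻¹ ^ 3) / 2 -
          (⨅ Q : PeriodicConfiguration 3, Q.energyPerParticle lennardJones)) /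
        ((ω.filter (fun q : E3 => ‖q - y‖ ≤ r)).card : ℝ) := by
    rw [hμS, Measure.restrict_restrict measurableSet_closedBall]
    have hcoe : (Measure.count : Measure E3).restrict (closedBall (0 : E3) r ∩ S) =
        (Measure.count : Measure E3).restrict (↑hfinr.toFinset : Set E3) := by rw [Finite.coe_toFinset]
    rw [hcoe, integral_count_restrict_coe_finset, hωr]
    refine Finset.sum_congr rfl fun y hy => ?_
    have hyr : ‖y‖ ≤ r := (Finset.mem_filter.mp hy).2
    have hfinRc : (closedBall y Rc ∩ S).Finite := finite_inter_of_separated h7 hsep (isCompact_closedBall y Rc)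
    have hfinyr : (closedBall y r ∩ S).Finite := finite_inter_of_separated h7 hsep (isCompact_closedBall y r)
    rw [setIntegral_map_sub_eq_sum y Rc hfinRc, hfilt y hyr Rc (by linarith) hfinRc, map_sub_apply_closedBall,
      count_restrict_closedBall_eq_card y r hfinyr, hfilt y hyr r (by linarith) hfinyr, ENNReal.toReal_natCast]
  rw [heq]
  exact hpos

/-- **FORCE-LOADED FINITE-CLUSTER DOOR (crux, by name).** [folklore] -/
theorem aperiodicFrustratedLawGap_of_forceFiniteClusterPrice
    (h : ∀ δ : ℝ, 0 < δ → ∀ R₇ R₈ R₉ : ℝ, let Gy : ℝ → (N : ℕ) → (Fin N → EuclideanSpace ℝ (Fin 3)) → Fin N → Prop := fun η N y j => let d : ℝ := sInf ((fun z => dist z (y (j : Fin N))) '' (Set.range (y) \ {(y (j : Fin N))})); let T : Set (EuclideanSpace ℝ (Fin 3)) := {z : EuclideanSpace ℝ (Fin 3) | z ∈ Set.range (y) ∧ z ≠ (y (j : Fin N)) ∧ dist z (y (j : Fin N)) < 13 / 10 * d}; ∃ A : EuclideanSpace ℝ (Fin 3) →ₗᵢ[ℝ] EuclideanSpace ℝ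 (Fin 3), (∃ e : ↥T ≃ ↥Literature.Geometry.DiscreteGeometry.fccKissingPattern, ∀ t : ↥T, dist (d⁻¹ • ((t : EuclideanSpace ℝ (Fin 3)) - (y (j : Fin N)))) (A ((e t : ↥Literature.Geometry.DiscreteGeometry.fccKissingPattern) : EuclideanSpace ℝ (Fin 3))) ≤ η) ∨ (∃ e : ↥T ≃ ↥Literature.Geometry.DiscreteGeometry.hcpKissingPattern, ∀ t : ↥T, dist (d⁻¹ • ((t : EuclideanSpace ℝ (Fin 3)) - (y (j : Fin N)))) (A ((e t : ↥Literature.Geometry.DiscreteGeometry.hcpKissingPattern) : EuclideanSpace ℝ (Fin 3))) ≤ η); let TexBall : (N : ℕ) → (Fin N → EuclideanSpace ℝ (Fin 3)) → Fin N → ℝ → ℝ → ℝ → ℝ → Prop := fun N y i R R₇ R₈ R₉ => (∀ a b : Fin N, a ≠ b → (7 : ℝ) / 10 ≤ dist (y a) (y b)) ∧ (∀ j : Fin N, dist (y j) (y i) ≤ R → ¬ Gy (1 / 20) N (y) j) ∧ (∀ j : Fin N, dist (y j) (y i) ≤ R → ¬ ((∀ j' : Fin N, dist (y j') (y j) ≤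 R₇ → ¬ Gy (1 / 20) N (y) j') ∧ (∀ z : EuclideanSpace ℝ (Fin 3), dist z (y j) ≤ R₇ → ∃ k : Fin N, dist z (y k) ≤ 1) ∧ (∀ j' : Fin N, dist (y j') (y j) ≤ R₇ → (let d : ℝ := sInf ((fun z => dist z (y j')) '' (Set.range (y) \ {(y j')})); ∀ k : Fin N, y k ≠ y j' → dist (y k) (y j') < 27 / 20 * d → 5 ≤ Nat.card {m : Fin N // y m ≠ y j' ∧ dist (y m) (y j') < 27 / 20 * d ∧ y m ≠ y k ∧ dist (y m) (y k) < 27 / 20 * d})))) ∧ (∀ j : Fin N, dist (y j) (y i) ≤ R → ∃ k : Fin N, dist (y k) (y j) ≤ R₈ ∧ Gy (1 / 8) N (y) k) ∧ (∀ j : Fin N, dist (y j) (y i) ≤ R → ¬ ((∀ j' : Fin N, dist (y j') (y j) ≤ R₉ → ¬ Gy (1 / 20) N (y) j') ∧ (Nat.card {j' : Fin N // dist (y j') (y j) ≤ R₉ ∧ ¬ Gy (1 / 8) N (y) j'} : ℝ) ≤ 1 / 2 * (Nat.card {j' : Fin N // dist (y j') (y j) ≤ R₉} : ℝ) ∧ (∀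 j' : Fin N, dist (y j') (y j) ≤ R₉ → ¬ Gy (1 / 8) N (y) j' → ¬ (let d : ℝ := sInf ((fun z => dist z (y j')) '' (Set.range (y) \ {(y j')})); ∀ k : Fin N, y k ≠ y j' → dist (y k) (y j') < 27 / 20 * d → 5 ≤ Nat.card {m : Fin N // y m ≠ y j' ∧ dist (y m) (y j') < 27 / 20 * d ∧ y m ≠ y k ∧ dist (y m) (y k) < 27 / 20 * d})))); ∃ r : ℝ, 0 < r ∧ ∃ Rc : ℝ, 6 / 5 ≤ Rc ∧ ∀ ω : Finset (EuclideanSpace ℝ (Fin 3)), (0 : EuclideanSpace ℝ (Fin 3)) ∈ ω → (∀ p ∈ ω, ‖p‖ ≤ 2 * r + Rc + 1) → (∀ a ∈ ω, ∀ b ∈ ω, a ≠ b → δ ≤ dist a b) → (∀ a ∈ ω, ∀ b ∈ ω, a ≠ b → (7 : ℝ) / 10 ≤ dist a b) → (∀ q ∈ ω, ‖q‖ ≤ r → ∀ ε : ℝ, 0 < ε → ε ≤ 1 → ∃ (N : ℕ) (y : Fin N → EuclideanSpace ℝ (Fin 3)) (i : Fin N), TexBall N y i (r + Rc) R₇ R₈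 R₉ ∧ (∀ p ∈ ω, dist p q ≤ r + Rc → ∃ k : Fin N, dist (y k - y i) (p - q) ≤ ε) ∧ (∀ k : Fin N, dist (y k) (y i) ≤ r + Rc → ∃ p ∈ ω, dist (y k - y i) (p - q) ≤ ε)) → (∀ p ∈ ω, ‖p‖ ≤ r → ∃ q ∈ ω, q ≠ p ∧ dist p q ^ 6 ≤ 11 / 5) → (∀ p ∈ ω, ‖p‖ ≤ r → 0 ≤ ∑ q ∈ ω.filter (fun q : EuclideanSpace ℝ (Fin 3) => q ≠ p ∧ ‖q - p‖ ≤ Rc), (11 * (dist p q)⁻¹ ^ 14 - 5 * (dist p q)⁻¹ ^ 8)) → (∀ p ∈ ω, ‖p‖ ≤ r → ‖∑ q ∈ ω.filter (fun q : EuclideanSpace ℝ (Fin 3) => q ≠ p ∧ ‖q - p‖ ≤ Rc), (((dist p q)⁻¹ ^ 8 - (dist p q)⁻¹ ^ 14) • (p - q))‖ ≤ (Rc⁻¹ ^ 7 + Rc⁻¹) * (250 * (7 / 10 : ℝ)⁻¹ ^ 3 * Rc⁻¹ ^ 3)) → 0 < (∑ y ∈ ω.filter (fun y : EuclideanSpace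 ℝ (Fin 3) => ‖y‖ ≤ r), ((∑ q ∈ ω.filter (fun q : EuclideanSpace ℝ (Fin 3) => ‖q - y‖ ≤ Rc), Literature.MathematicalPhysics.StatisticalMechanics.lennardJones ‖q - y‖) / 2 - ((7 / 10 : ℝ)⁻¹ ^ 6 / 12 + 1 / 6) * (250 * (7 / 10 : ℝ)⁻¹ ^ 3 * Rc⁻¹ ^ 3) / 2 - (⨅ Q : Literature.MathematicalPhysics.StatisticalMechanics.PeriodicConfiguration 3, Q.energyPerParticle Literature.MathematicalPhysics.StatisticalMechanics.lennardJones)) / ((ω.filter (fun q : EuclideanSpace ℝ (Fin 3) => ‖q - y‖ ≤ r)).card : ℝ))) :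
    Summit.AtomisticToContinuum.Crystallization.Theses.FrustratedLawDichotomy.AperiodicFrustratedLawGap :=
  aperiodicFrustratedLawGap_of_truncatedSurplusPrice (truncatedSurplusPrice_of_forceFiniteClusterPrice h)

/-- **FORCE-LOADED FINITE-CLUSTER DOOR for the registered stub** (`S_aperiodicErgodicGap` verbatim). [folklore] -/
theorem aperiodicErgodicGap_of_forceFiniteClusterPrice
    (h : ∀ δ : ℝ, 0 < δ → ∀ R₇ R₈ R₉ : ℝ, let Gy : ℝ → (N : ℕ) → (Fin N → EuclideanSpace ℝ (Fin 3)) → Fin N → Prop := fun η N y j => let d : ℝ := sInf ((fun z => dist z (y (j : Fin N))) '' (Set.range (y) \ {(y (j : Fin N))})); let T : Set (EuclideanSpace ℝ (Fin 3)) := {z : EuclideanSpace ℝ (Fin 3) | z ∈ Set.range (y) ∧ z ≠ (y (j : Fin N)) ∧ dist z (y (j : Fin N)) < 13 / 10 * d}; ∃ A : EuclideanSpace ℝ (Fin 3) →ₗᵢ[ℝ] EuclideanSpace ℝ (Fin 3), (∃ e : ↥T ≃ ↥Literature.Geometry.DiscreteGeometry.fccKissingPattern, ∀ t : ↥T, dist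 (d⁻¹ • ((t : EuclideanSpace ℝ (Fin 3)) - (y (j : Fin N)))) (A ((e t : ↥Literature.Geometry.DiscreteGeometry.fccKissingPattern) : EuclideanSpace ℝ (Fin 3))) ≤ η) ∨ (∃ e : ↥T ≃ ↥Literature.Geometry.DiscreteGeometry.hcpKissingPattern, ∀ t : ↥T, dist (d⁻¹ • ((t : EuclideanSpace ℝ (Fin 3)) - (y (j : Fin N)))) (A ((e t : ↥Literature.Geometry.DiscreteGeometry.hcpKissingPattern) : EuclideanSpace ℝ (Fin 3))) ≤ η); let TexBall : (N : ℕ) → (Fin N → EuclideanSpace ℝ (Fin 3)) → Fin N → ℝ → ℝ → ℝ → ℝ → Prop := fun N y i R R₇ R₈ R₉ => (∀ a b : Fin N, a ≠ b → (7 : ℝ) / 10 ≤ dist (y a) (y b)) ∧ (∀ j : Fin N, dist (y j) (y i) ≤ R → ¬ Gy (1 / 20) N (y) j) ∧ (∀ j : Fin N, dist (y j) (y i) ≤ R → ¬ ((∀ j' : Fin N, dist (y j') (y j) ≤ R₇ → ¬ Gy (1 / 20) N (y) j') ∧ (∀ z : EuclideanSpace ℝ (Fin 3), dist z (y j) ≤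 R₇ → ∃ k : Fin N, dist z (y k) ≤ 1) ∧ (∀ j' : Fin N, dist (y j') (y j) ≤ R₇ → (let d : ℝ := sInf ((fun z => dist z (y j')) '' (Set.range (y) \ {(y j')})); ∀ k : Fin N, y k ≠ y j' → dist (y k) (y j') < 27 / 20 * d → 5 ≤ Nat.card {m : Fin N // y m ≠ y j' ∧ dist (y m) (y j') < 27 / 20 * d ∧ y m ≠ y k ∧ dist (y m) (y k) < 27 / 20 * d})))) ∧ (∀ j : Fin N, dist (y j) (y i) ≤ R → ∃ k : Fin N, dist (y k) (y j) ≤ R₈ ∧ Gy (1 / 8) N (y) k) ∧ (∀ j : Fin N, dist (y j) (y i) ≤ R → ¬ ((∀ j' : Fin N, dist (y j') (y j) ≤ R₉ → ¬ Gy (1 / 20) N (y) j') ∧ (Nat.card {j' : Fin N // dist (y j') (y j) ≤ R₉ ∧ ¬ Gy (1 / 8) N (y) j'} : ℝ) ≤ 1 / 2 * (Nat.card {j' : Fin N // dist (y j') (y j) ≤ R₉} : ℝ) ∧ (∀ j' : Fin N, dist (y j') (y j) ≤ R₉ → ¬ Gy (1 / 8) N (y) j' → ¬ (let d : ℝ :=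 sInf ((fun z => dist z (y j')) '' (Set.range (y) \ {(y j')})); ∀ k : Fin N, y k ≠ y j' → dist (y k) (y j') < 27 / 20 * d → 5 ≤ Nat.card {m : Fin N // y m ≠ y j' ∧ dist (y m) (y j') < 27 / 20 * d ∧ y m ≠ y k ∧ dist (y m) (y k) < 27 / 20 * d})))); ∃ r : ℝ, 0 < r ∧ ∃ Rc : ℝ, 6 / 5 ≤ Rc ∧ ∀ ω : Finset (EuclideanSpace ℝ (Fin 3)), (0 : EuclideanSpace ℝ (Fin 3)) ∈ ω → (∀ p ∈ ω, ‖p‖ ≤ 2 * r + Rc + 1) → (∀ a ∈ ω, ∀ b ∈ ω, a ≠ b → δ ≤ dist a b) → (∀ a ∈ ω, ∀ b ∈ ω, a ≠ b → (7 : ℝ) / 10 ≤ dist a b) → (∀ q ∈ ω, ‖q‖ ≤ r → ∀ ε : ℝ, 0 < ε → ε ≤ 1 → ∃ (N : ℕ) (y : Fin N → EuclideanSpace ℝ (Fin 3)) (i : Fin N), TexBall N y i (r + Rc) R₇ R₈ R₉ ∧ (∀ p ∈ ω, dist p q ≤ r + Rc → ∃ k : Fin N, dist (y k - y i) (p - q)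 ≤ ε) ∧ (∀ k : Fin N, dist (y k) (y i) ≤ r + Rc → ∃ p ∈ ω, dist (y k - y i) (p - q) ≤ ε)) → (∀ p ∈ ω, ‖p‖ ≤ r → ∃ q ∈ ω, q ≠ p ∧ dist p q ^ 6 ≤ 11 / 5) → (∀ p ∈ ω, ‖p‖ ≤ r → 0 ≤ ∑ q ∈ ω.filter (fun q : EuclideanSpace ℝ (Fin 3) => q ≠ p ∧ ‖q - p‖ ≤ Rc), (11 * (dist p q)⁻¹ ^ 14 - 5 * (dist p q)⁻¹ ^ 8)) → (∀ p ∈ ω, ‖p‖ ≤ r → ‖∑ q ∈ ω.filter (fun q : EuclideanSpace ℝ (Fin 3) => q ≠ p ∧ ‖q - p‖ ≤ Rc), (((dist p q)⁻¹ ^ 8 - (dist p q)⁻¹ ^ 14) • (p - q))‖ ≤ (Rc⁻¹ ^ 7 + Rc⁻¹) * (250 * (7 / 10 : ℝ)⁻¹ ^ 3 * Rc⁻¹ ^ 3)) → 0 < (∑ y ∈ ω.filter (fun y : EuclideanSpace ℝ (Fin 3) => ‖y‖ ≤ r), ((∑ q ∈ ω.filter (fun q : EuclideanSpace ℝ (Fin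 3) => ‖q - y‖ ≤ Rc), Literature.MathematicalPhysics.StatisticalMechanics.lennardJones ‖q - y‖) / 2 - ((7 / 10 : ℝ)⁻¹ ^ 6 / 12 + 1 / 6) * (250 * (7 / 10 : ℝ)⁻¹ ^ 3 * Rc⁻¹ ^ 3) / 2 - (⨅ Q : Literature.MathematicalPhysics.StatisticalMechanics.PeriodicConfiguration 3, Q.energyPerParticle Literature.MathematicalPhysics.StatisticalMechanics.lennardJones)) / ((ω.filter (fun q : EuclideanSpace ℝ (Fin 3) => ‖q - y‖ ≤ r)).card : ℝ))) :
    ∀ δ : ℝ, 0 < δ → ∀ P : MeasureTheory.Measure (MeasureTheory.Measure (EuclideanSpace ℝ (Fin 3))), let Gy : ℝ → (N : ℕ) → (Fin N → EuclideanSpace ℝ (Fin 3)) → Fin N → Prop := fun η N y j => let d : ℝ := sInf ((fun z => dist z (y (j : Fin N))) '' (Set.range (y) \ {(y (j : Fin N))})); let T : Set (EuclideanSpace ℝ (Fin 3)) := {z : EuclideanSpace ℝ (Fin 3) | z ∈ Set.range (y) ∧ z ≠ (y (j : Fin N)) ∧ dist z (y (j : Fin N)) < 13 / 10 * d}; ∃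 A : EuclideanSpace ℝ (Fin 3) →ₗᵢ[ℝ] EuclideanSpace ℝ (Fin 3), (∃ e : ↥T ≃ ↥Literature.Geometry.DiscreteGeometry.fccKissingPattern, ∀ t : ↥T, dist (d⁻¹ • ((t : EuclideanSpace ℝ (Fin 3)) - (y (j : Fin N)))) (A ((e t : ↥Literature.Geometry.DiscreteGeometry.fccKissingPattern) : EuclideanSpace ℝ (Fin 3))) ≤ η) ∨ (∃ e : ↥T ≃ ↥Literature.Geometry.DiscreteGeometry.hcpKissingPattern, ∀ t : ↥T, dist (d⁻¹ • ((t : EuclideanSpace ℝ (Fin 3)) - (y (j : Fin N)))) (A ((e t : ↥Literature.Geometry.DiscreteGeometry.hcpKissingPattern) : EuclideanSpace ℝ (Fin 3))) ≤ η); let TexBall : (N : ℕ) → (Fin N → EuclideanSpace ℝ (Fin 3)) → Fin N → ℝ → ℝ → ℝ → ℝ → Prop := fun N y i R R₇ R₈ R₉ => (∀ a b : Fin N, a ≠ b → (7 : ℝ) / 10 ≤ dist (y a) (y b)) ∧ (∀ j : Fin N, dist (y j) (y i) ≤ R → ¬ Gy (1 / 20) N (y) j) ∧ (∀ j : Fin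 N, dist (y j) (y i) ≤ R → ¬ ((∀ j' : Fin N, dist (y j') (y j) ≤ R₇ → ¬ Gy (1 / 20) N (y) j') ∧ (∀ z : EuclideanSpace ℝ (Fin 3), dist z (y j) ≤ R₇ → ∃ k : Fin N, dist z (y k) ≤ 1) ∧ (∀ j' : Fin N, dist (y j') (y j) ≤ R₇ → (let d : ℝ := sInf ((fun z => dist z (y j')) '' (Set.range (y) \ {(y j')})); ∀ k : Fin N, y k ≠ y j' → dist (y k) (y j') < 27 / 20 * d → 5 ≤ Nat.card {m : Fin N // y m ≠ y j' ∧ dist (y m) (y j') < 27 / 20 * d ∧ y m ≠ y k ∧ dist (y m) (y k) < 27 / 20 * d})))) ∧ (∀ j : Fin N, dist (y j) (y i) ≤ R → ∃ k : Fin N, dist (y k) (y j) ≤ R₈ ∧ Gy (1 / 8) N (y) k) ∧ (∀ j : Fin N, dist (y j) (y i) ≤ R → ¬ ((∀ j' : Fin N, dist (y j') (y j) ≤ R₉ → ¬ Gy (1 / 20) N (y) j') ∧ (Nat.card {j' : Fin N // dist (y j') (y j) ≤ R₉ ∧ ¬ Gy (1 / 8) N (y) j'} : ℝ) ≤ 1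 / 2 * (Nat.card {j' : Fin N // dist (y j') (y j) ≤ R₉} : ℝ) ∧ (∀ j' : Fin N, dist (y j') (y j) ≤ R₉ → ¬ Gy (1 / 8) N (y) j' → ¬ (let d : ℝ := sInf ((fun z => dist z (y j')) '' (Set.range (y) \ {(y j')})); ∀ k : Fin N, y k ≠ y j' → dist (y k) (y j') < 27 / 20 * d → 5 ≤ Nat.card {m : Fin N // y m ≠ y j' ∧ dist (y m) (y j') < 27 / 20 * d ∧ y m ≠ y k ∧ dist (y m) (y k) < 27 / 20 * d})))); let Appr : MeasureTheory.Measure (EuclideanSpace ℝ (Fin 3)) → ℝ → ℝ → ℝ → Prop := fun μ R₇ R₈ R₉ => ∀ q : EuclideanSpace ℝ (Fin 3), μ {q} ≠ 0 → ∀ R ε : ℝ, 0 < ε → ∃ (N : ℕ) (y : Fin N → EuclideanSpace ℝ (Fin 3)) (i : Fin N), TexBall N y i R R₇ R₈ R₉ ∧ (∀ p : EuclideanSpace ℝ (Fin 3), μ {p} ≠ 0 → dist p q ≤ R → ∃ k : Fin N, dist (y k - y i) (p - q) ≤ ε) ∧ (∀ k : Fin N, dist (y k) (y i) ≤ R → ∃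 p : EuclideanSpace ℝ (Fin 3), μ {p} ≠ 0 ∧ dist (y k - y i) (p - q) ≤ ε); MeasureTheory.IsProbabilityMeasure P → (∀ᵐ μ ∂P, Literature.Probability.Process.IsRootedHardCore δ μ) → Literature.Probability.Process.IsPointStationaryLaw P → (∃ R₇ R₈ R₉ : ℝ, ∀ᵐ μ ∂P, Appr μ R₇ R₈ R₉) → (∀ᵐ μ ∂P, ∀ p : EuclideanSpace ℝ (Fin 3), μ {p} ≠ 0 → ∀ y : EuclideanSpace ℝ (Fin 3), (∀ q : EuclideanSpace ℝ (Fin 3), μ {q} ≠ 0 → q ≠ p → y ≠ q) → ∑' q : {q : EuclideanSpace ℝ (Fin 3) // μ {q} ≠ 0 ∧ q ≠ p}, Literature.MathematicalPhysics.StatisticalMechanics.lennardJones (dist p (q : EuclideanSpace ℝ (Fin 3))) ≤ ∑' q : {q : EuclideanSpace ℝ (Fin 3) // μ {q} ≠ 0 ∧ q ≠ p}, Literature.MathematicalPhysics.StatisticalMechanics.lennardJones (dist y (q : EuclideanSpace ℝ (Fin 3)))) → P {μ : MeasureTheory.Measure (EuclideanSpace ℝ (Fin 3)) | ∃ Q :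 Literature.MathematicalPhysics.StatisticalMechanics.PeriodicConfiguration 3, ∃ t : EuclideanSpace ℝ (Fin 3), {p : EuclideanSpace ℝ (Fin 3) | μ {p} ≠ 0} = (fun s => s + t) '' Q.points} = 0 → (∀ A : Set (MeasureTheory.Measure (EuclideanSpace ℝ (Fin 3))), MeasurableSet A → (∀ μ : MeasureTheory.Measure (EuclideanSpace ℝ (Fin 3)), ∀ p : EuclideanSpace ℝ (Fin 3), μ {p} ≠ 0 → (μ ∈ A ↔ MeasureTheory.Measure.map (fun z : EuclideanSpace ℝ (Fin 3) => z - p) μ ∈ A)) → P A = 0 ∨ P Aᶜ = 0) → (⨅ Q : Literature.MathematicalPhysics.StatisticalMechanics.PeriodicConfiguration 3, Q.energyPerParticle Literature.MathematicalPhysics.StatisticalMechanics.lennardJones) < (∫ μ, Literature.MathematicalPhysics.StatisticalMechanics.rootEnergy Literature.MathematicalPhysics.StatisticalMechanics.lennardJones μ ∂P) :=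
  aperiodicErgodicGap_of_truncatedSurplusPrice (truncatedSurplusPrice_of_forceFiniteClusterPrice h)

/-- **FORCE-LOADED FINITE-CLUSTER DOOR for the `PeriodicChargeSplit` copy.** [folklore] -/
theorem periodicChargeSplit_aperiodicFrustratedLawGap_of_forceFiniteClusterPrice
    (h : ∀ δ : ℝ, 0 < δ → ∀ R₇ R₈ R₉ : ℝ, let Gy : ℝ → (N : ℕ) → (Fin N → EuclideanSpace ℝ (Fin 3)) → Fin N → Prop := fun η N y j => let d : ℝ := sInf ((fun z => dist z (y (j : Fin N))) '' (Set.range (y) \ {(y (j : Fin N))})); let T : Set (EuclideanSpace ℝ (Fin 3)) := {z : EuclideanSpace ℝ (Fin 3) | z ∈ Set.range (y) ∧ z ≠ (y (j : Fin N)) ∧ dist z (y (j : Fin N)) < 13 / 10 * d}; ∃ A : EuclideanSpace ℝ (Fin 3) →ₗᵢ[ℝ] EuclideanSpace ℝ (Fin 3), (∃ e : ↥T ≃ ↥Literature.Geometry.DiscreteGeometry.fccKissingPattern, ∀ t : ↥T, dist (d⁻¹ • ((t : EuclideanSpace ℝ (Fin 3)) - (y (j : Fin N)))) (A ((e t : ↥Literature.Geometry.DiscreteGeometry.fccKissingPattern)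 : EuclideanSpace ℝ (Fin 3))) ≤ η) ∨ (∃ e : ↥T ≃ ↥Literature.Geometry.DiscreteGeometry.hcpKissingPattern, ∀ t : ↥T, dist (d⁻¹ • ((t : EuclideanSpace ℝ (Fin 3)) - (y (j : Fin N)))) (A ((e t : ↥Literature.Geometry.DiscreteGeometry.hcpKissingPattern) : EuclideanSpace ℝ (Fin 3))) ≤ η); let TexBall : (N : ℕ) → (Fin N → EuclideanSpace ℝ (Fin 3)) → Fin N → ℝ → ℝ → ℝ → ℝ → Prop := fun N y i R R₇ R₈ R₉ => (∀ a b : Fin N, a ≠ b → (7 : ℝ) / 10 ≤ dist (y a) (y b)) ∧ (∀ j : Fin N, dist (y j) (y i) ≤ R → ¬ Gy (1 / 20) N (y) j) ∧ (∀ j : Fin N, dist (y j) (y i) ≤ R → ¬ ((∀ j' : Fin N, dist (y j') (y j) ≤ R₇ → ¬ Gy (1 / 20) N (y) j') ∧ (∀ z : EuclideanSpace ℝ (Fin 3), dist z (y j) ≤ R₇ → ∃ k : Fin N, dist z (y k) ≤ 1) ∧ (∀ j' : Fin N, dist (y j') (y j) ≤ R₇ → (let d : ℝ := sInf ((fun z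 => dist z (y j')) '' (Set.range (y) \ {(y j')})); ∀ k : Fin N, y k ≠ y j' → dist (y k) (y j') < 27 / 20 * d → 5 ≤ Nat.card {m : Fin N // y m ≠ y j' ∧ dist (y m) (y j') < 27 / 20 * d ∧ y m ≠ y k ∧ dist (y m) (y k) < 27 / 20 * d})))) ∧ (∀ j : Fin N, dist (y j) (y i) ≤ R → ∃ k : Fin N, dist (y k) (y j) ≤ R₈ ∧ Gy (1 / 8) N (y) k) ∧ (∀ j : Fin N, dist (y j) (y i) ≤ R → ¬ ((∀ j' : Fin N, dist (y j') (y j) ≤ R₉ → ¬ Gy (1 / 20) N (y) j') ∧ (Nat.card {j' : Fin N // dist (y j') (y j) ≤ R₉ ∧ ¬ Gy (1 / 8) N (y) j'} : ℝ) ≤ 1 / 2 * (Nat.card {j' : Fin N // dist (y j') (y j) ≤ R₉} : ℝ) ∧ (∀ j' : Fin N, dist (y j') (y j) ≤ R₉ → ¬ Gy (1 / 8) N (y) j' → ¬ (let d : ℝ := sInf ((fun z => dist z (y j')) '' (Set.range (y) \ {(y j')})); ∀ k : Fin N, y k ≠ y j' → dist (y k) (y j') < 27 / 20 * d → 5 ≤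 Nat.card {m : Fin N // y m ≠ y j' ∧ dist (y m) (y j') < 27 / 20 * d ∧ y m ≠ y k ∧ dist (y m) (y k) < 27 / 20 * d})))); ∃ r : ℝ, 0 < r ∧ ∃ Rc : ℝ, 6 / 5 ≤ Rc ∧ ∀ ω : Finset (EuclideanSpace ℝ (Fin 3)), (0 : EuclideanSpace ℝ (Fin 3)) ∈ ω → (∀ p ∈ ω, ‖p‖ ≤ 2 * r + Rc + 1) → (∀ a ∈ ω, ∀ b ∈ ω, a ≠ b → δ ≤ dist a b) → (∀ a ∈ ω, ∀ b ∈ ω, a ≠ b → (7 : ℝ) / 10 ≤ dist a b) → (∀ q ∈ ω, ‖q‖ ≤ r → ∀ ε : ℝ, 0 < ε → ε ≤ 1 → ∃ (N : ℕ) (y : Fin N → EuclideanSpace ℝ (Fin 3)) (i : Fin N), TexBall N y i (r + Rc) R₇ R₈ R₉ ∧ (∀ p ∈ ω, dist p q ≤ r + Rc → ∃ k : Fin N, dist (y k - y i) (p - q) ≤ ε) ∧ (∀ k : Fin N, dist (y k) (y i) ≤ r + Rc → ∃ p ∈ ω, dist (y k - y i) (p - q) ≤ ε)) → (∀ p ∈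 ω, ‖p‖ ≤ r → ∃ q ∈ ω, q ≠ p ∧ dist p q ^ 6 ≤ 11 / 5) → (∀ p ∈ ω, ‖p‖ ≤ r → 0 ≤ ∑ q ∈ ω.filter (fun q : EuclideanSpace ℝ (Fin 3) => q ≠ p ∧ ‖q - p‖ ≤ Rc), (11 * (dist p q)⁻¹ ^ 14 - 5 * (dist p q)⁻¹ ^ 8)) → (∀ p ∈ ω, ‖p‖ ≤ r → ‖∑ q ∈ ω.filter (fun q : EuclideanSpace ℝ (Fin 3) => q ≠ p ∧ ‖q - p‖ ≤ Rc), (((dist p q)⁻¹ ^ 8 - (dist p q)⁻¹ ^ 14) • (p - q))‖ ≤ (Rc⁻¹ ^ 7 + Rc⁻¹) * (250 * (7 / 10 : ℝ)⁻¹ ^ 3 * Rc⁻¹ ^ 3)) → 0 < (∑ y ∈ ω.filter (fun y : EuclideanSpace ℝ (Fin 3) => ‖y‖ ≤ r), ((∑ q ∈ ω.filter (fun q : EuclideanSpace ℝ (Fin 3) => ‖q - y‖ ≤ Rc), Literature.MathematicalPhysics.StatisticalMechanics.lennardJones ‖q - y‖) / 2 - ((7 / 10 : ℝ)⁻¹ ^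 6 / 12 + 1 / 6) * (250 * (7 / 10 : ℝ)⁻¹ ^ 3 * Rc⁻¹ ^ 3) / 2 - (⨅ Q : Literature.MathematicalPhysics.StatisticalMechanics.PeriodicConfiguration 3, Q.energyPerParticle Literature.MathematicalPhysics.StatisticalMechanics.lennardJones)) / ((ω.filter (fun q : EuclideanSpace ℝ (Fin 3) => ‖q - y‖ ≤ r)).card : ℝ))) :
    Summit.AtomisticToContinuum.Crystallization.Theses.PeriodicChargeSplit.AperiodicFrustratedLawGap :=
  periodicChargeSplit_aperiodicFrustratedLawGap_of_truncatedSurplusPrice (truncatedSurplusPrice_of_forceFiniteClusterPrice h)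

end Summit.AtomisticToContinuum.Crystallization.Theorems.FrustratedLawDichotomyTransportPriceFiniteForce

end
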